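import Literature.AnabelianGeometry.SemiGraphs.PSCSeparatingCoveringsThreeChainPointed
import Literature.AnabelianGeometry.SemiGraphs.PSCSeparatingCoveringsTwoComponentUnmarkedEdgesOneCusp
import Literature.AnabelianGeometry.SemiGraphs.PSCSeparatingCoveringsTwoComponentAffineEdges
import Literature.AnabelianGeometry.SemiGraphs.PSCSeparatingCoveringsBoundaryNode
import HarnessLib

/-!
# [CombGC] Prop. 1.2, proof p. 9: EDGE-LIKE separating coverings at THREE-COMPONENT «COMB» CHAINS — an UNMARKED FIRST component carrying ALL the handles (row F-2827)

Mochizuki, *A combinatorial version of the Grothendieck conjecture*, Tohoku Math. J. **59** (2007)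
[CombGC], PROOF of Proposition 1.2, author's manuscript p. 9, the resp'd (edge) case
[cite: MochizukiCombGC2007, Prop 1.2 proof p.9]; typed LEVEL-WISE as `PSCDatum.EdgeLikeSeparatingCoverings`
(abc-iut-w4-d081, row P12-L01-E; abc-iut FACT-LIST row F-2827 — a schema whose universal closure is refuted as
typed; the instance forms at genuine carriers are the content).

PROOF-ONLY file (abc-iut-f-166 gen 6, row «UNMARKED-FIRST-CHAIN», file 5 = the sub-corner `g₀ = g₁ = g` left
open by file 1; 0 definitions).  The carrier: abc-iut-f-164's three-component chain
`C₀ ∪_{ν_A} C_mid ∪_{ν_B} C₁` whose FIRST component is UNMARKED and carries ALL the handles (`g₀ = g₁ = g ≥ 1`,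
`s₂ = r`; `C_mid`, `C₁` rational, `2 ≤ s₁ < r`), over a profinite pro-`Σ` completion `ι : Γ_{g,r} → Π`.  Here
abc-iut-f-060's node twist (which wants a handle OFF `C₀`) is replaced, for the pair `ν_A/ν_A`, by abc-iut-f-164's
BOUNDARY-NODE theorem: `ε_A = ∏_{i<g}[a_i,b_i] = (c_0⋯c_{r−1})⁻¹` (surface relation) is, up to inversion, the
boundary word of the closed component `⟨a_i, b_i⟩ = θ(Γ_{g,1})`, `θ = exists_hom_closedComponent (g₀ := 0)`.
All other pairs exactly as in file 1 (`PSCSeparatingCoveringsThreeChainUnmarkedFirstEdges.lean`): `ν_B/ν_B`,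
`c/c` by gen 3's fibred twist, cross pairs through `exists_open_separating_of_hom` with cusp characters
`δ_k − δ_m` and Heisenberg handle-cusp homomorphisms at the handle `0`.

* `edgeLikeSeparatingCoverings_of_threeChain_unmarkedFirst_comb` — **F-2827** (`V' := V`) at EVERY such datum.

Instance forms at data of the shape of genuine stable curves: consistency evidence for the typed schema, not
the printed theorem for all pointed stable curves.  Nothing here takes a side on [IUTchIII] Cor. 3.12.
-/


noncomputable section

namespace Literature.AnabelianGeometry.SemiGraphs

namespace PSCDatum

open scoped Pointwise
open Multiplicative
open Literature.AnabelianGeometry.Anabelioids (IsSigmaInteger)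
open Literature.GroupTheory.CombinatorialGroupTheory
open Literature.GroupTheory.CombinatorialGroupTheory.PuncturedSurfaceGroup (a b c cuspInertia
  exists_freeGroupBasis_nodeLoop exists_freeGroupBasis_eq_c exists_handleCuspCharacter exists_hom_closedComponent
  comm_prod_mul_cusp_prod_eq_one exists_hom_handle_cusp hom_handle_cusp_nodeLoop)
open SemiGraphOfAnabelioids (IsProSigmaCompletion)
open SemiGraphOfAnabelioids.IsProSigmaCompletion (freeFactor_exists_open_separating_sameVertex
  boundaryNode_exists_open_separating_sameEdge exists_open_separating_of_hom)
open TwoComponentAffine (character_nodeLoop sum_ite_twoDelta sum_twoDelta)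

section ThreeChain

variable {P : Type} [Group P] [TopologicalSpace P] [IsTopologicalGroup P]
variable [CompactSpace P] [TotallyDisconnectedSpace P] {Sigma : Set ℕ} {g r : ℕ}

/-- **Row P12-L01-E / F-2827 (`EdgeLikeSeparatingCoverings`, `V' := V`) at EVERY three-component «comb» chain
datum: unmarked first component carrying all the handles** (`g₀ = g₁ = g ≥ 1`, `s₂ = r`, `2 ≤ s₁ < r`).
[cite: MochizukiCombGC2007, Prop 1.2 proof p.9] -/
theorem edgeLikeSeparatingCoverings_of_threeChain_unmarkedFirst_comb (hne : Sigma.Nonempty)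
    (hprime : ∀ p ∈ Sigma, p.Prime) (ι : PuncturedSurfaceGroup g r →* P)
    (hι : IsProSigmaCompletion Sigma ι) (G : PSCDatum P) {g₀ g₁ s₁ s₂ : ℕ} (hg₀g : g₀ = g) (hg₁g : g₁ = g)
    (hg1 : 1 ≤ g) (hs₁ : 2 ≤ s₁) (hs₁r : s₁ < r) (hs₂ : s₂ = r) (e : G.graph.C ≃ Fin r)
    (hC : ∀ c', G.cuspGp c' = ((cuspInertia (g := g) (e c')).map ι).topologicalClosure)
    (εA η : PuncturedSurfaceGroup g r)
    (hεA : εA = ((List.finRange r).map fun j : Fin r =>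
          if s₂ ≤ (j : ℕ) then PuncturedSurfaceGroup.c (g := g) j else 1).prod *
        ((List.finRange g).map fun i : Fin g => if (i : ℕ) < g₀ then
          PuncturedSurfaceGroup.a (r := r) i * PuncturedSurfaceGroup.b i *
            (PuncturedSurfaceGroup.a i)⁻¹ * (PuncturedSurfaceGroup.b i)⁻¹ else 1).prod)
    (hη : η = ((List.finRange r).map fun j : Fin r =>
          if s₁ ≤ (j : ℕ) then PuncturedSurfaceGroup.c (g := g) j else 1).prod *
        ((List.finRange g).map fun i : Fin g => if (i : ℕ) < g₁ then
          PuncturedSurfaceGroup.a (r := r) i * PuncturedSurfaceGroup.b i *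
            (PuncturedSurfaceGroup.a i)⁻¹ * (PuncturedSurfaceGroup.b i)⁻¹ else 1).prod)
    (nA nB : G.graph.N) (hN : ∀ n, n = nA ∨ n = nB)
    (hEA : G.nodeGp nA = ((Subgroup.zpowers εA).map ι).topologicalClosure)
    (hEB : G.nodeGp nB = ((Subgroup.zpowers η).map ι).topologicalClosure) :
    G.EdgeLikeSeparatingCoverings := by
  classical
  subst s₂
  obtain ⟨r', rfl⟩ : ∃ r', r = r' + 1 := ⟨r - 1, by omega⟩
  obtain ⟨g', rfl⟩ : ∃ g', g = 0 + g' := ⟨g, (Nat.zero_add g).symm⟩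
  subst g₀
  subst g₁
  have hst₁ : 1 ≤ 0 + g' - (0 + g') ∨ 2 ≤ s₁ := Or.inr hs₁
  obtain ⟨ℓ, hℓS⟩ := hne
  have hℓ : ℓ.Prime := hprime ℓ hℓS
  -- the node-loop basis of `(g, s₁)` (carries `η`)
  obtain ⟨bB, ha, hb, -, hkB⟩ := exists_freeGroupBasis_nodeLoop (0 + g') r' (0 + g') s₁ (by omega) (by omega) η hη
  -- `ε_A` is the closed-surface loop `∏_{i<g₀}[a_i,b_i]`
  have hcusp1 : ((List.finRange (r' + 1)).map fun j : Fin (r' + 1) =>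
      if r' + 1 ≤ (j : ℕ) then PuncturedSurfaceGroup.c (g := 0 + g') j else 1).prod = 1 :=
    List.prod_eq_one fun y hy => by
      obtain ⟨j, -, rfl⟩ := List.mem_map.mp hy
      exact if_neg (by omega)
  have hεx : εA = ((List.finRange (0 + g')).map fun i : Fin (0 + g') => if (i : ℕ) < 0 + g' then
      a (r := r' + 1) i * b i * (a i)⁻¹ * (b i)⁻¹ else 1).prod := by rw [hεA, hcusp1, one_mul]
  -- `η₀ = c_0⋯c_{r'} = ε_A⁻¹`: the boundary of the closed component carrying ALL the handles
  obtain ⟨η₀, hη₀⟩ : ∃ x : PuncturedSurfaceGroup (0 + g') (r' + 1), x = ((List.finRange (r' + 1)).map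
      fun j : Fin (r' + 1) => if 0 ≤ (j : ℕ) then c (g := 0 + g') j else 1).prod *
    ((List.finRange (0 + g')).map fun i : Fin (0 + g') => if (i : ℕ) < 0 then
      a (r := r' + 1) i * b i * (a i)⁻¹ * (b i)⁻¹ else 1).prod := ⟨_, rfl⟩
  obtain ⟨θ, hθinj, -, -, hθc, hθrange⟩ := exists_hom_closedComponent (g₀ := 0) (g₁ := g') (r' := r') η₀ hη₀
  have hεη : εA = η₀⁻¹ := by
    rw [eq_inv_iff_mul_eq_one, hεx, hη₀]
    have e1 : (fun i : Fin (0 + g') => if (i : ℕ) < 0 + g' then a (r := r' + 1) i * b i * (a i)⁻¹ * (b i)⁻¹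
        else 1) = fun i => a (r := r' + 1) i * b i * (a i)⁻¹ * (b i)⁻¹ := funext fun i => if_pos i.isLt
    have e2 : (fun j : Fin (r' + 1) => if 0 ≤ (j : ℕ) then c (g := 0 + g') j else 1) = fun j => c j :=
      funext fun j => if_pos (Nat.zero_le _)
    have e3 : ((List.finRange (0 + g')).map fun i : Fin (0 + g') => if (i : ℕ) < 0 then
        a (r := r' + 1) i * b i * (a i)⁻¹ * (b i)⁻¹ else 1).prod = 1 :=
      List.prod_eq_one fun y hy => by
        obtain ⟨i, -, rfl⟩ := List.mem_map.mp hy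
        exact if_neg (Nat.not_lt_zero _)
    rw [e1, e2, e3, mul_one]
    exact comm_prod_mul_cusp_prod_eq_one
  obtain ⟨S_H, hS_H⟩ : ∃ S : Set ((Fin (0 + g') × Bool) ⊕ Fin r'),
      S = {x | Sum.elim (fun _ : Fin (0 + g') × Bool => True) (fun _ : Fin r' => False) x} := ⟨_, rfl⟩
  have hθB : θ.range = Subgroup.closure (bB '' S_H) := by
    rw [hθrange, hS_H]
    congr 1
    ext x
    constructor
    · rintro ⟨i, -, rfl | rfl⟩
      · exact ⟨Sum.inl (i, false), trivial, ha i⟩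
      · exact ⟨Sum.inl (i, true), trivial, hb i⟩
    · rintro ⟨y, hy, rfl⟩
      rcases y with ⟨i, _ | _⟩ | j
      · exact ⟨i, Nat.zero_le _, Or.inl (ha i)⟩
      · exact ⟨i, Nat.zero_le _, Or.inr (hb i)⟩
      · exact absurd hy id
  -- the node generators (`nA ≠ nB` is not needed: the other node is `nB` by `hN`)
  obtain ⟨xs, hxs⟩ : ∃ f : G.graph.N → PuncturedSurfaceGroup (0 + g') (r' + 1),
      f = fun n => if n = nA then εA else η := ⟨_, rfl⟩
  have hxA : ∀ n, n = nA → xs n = εA := fun n hn => by rw [hxs]; exact if_pos hn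
  have hxB : ∀ n, n ≠ nA → xs n = η := fun n hn => by rw [hxs]; exact if_neg hn
  have hEn : ∀ n, G.edgeGp (Sum.inl n) = ((Subgroup.zpowers (xs n)).map ι).topologicalClosure := by
    intro n
    change G.nodeGp n = _
    by_cases hn : n = nA
    · rw [hxA n hn, hn, hEA]
    · rcases hN n with h | h
      · exact absurd h hn
      · rw [hxB n hn, h, hEB]
  have hEc : ∀ c', G.edgeGp (Sum.inr c') = ((Subgroup.zpowers (c (e c'))).map ι).topologicalClosure :=
    fun c' => hC c'
  have hslot : s₁ - 1 < r' := by omega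
  have hEnB : ∀ n, n ≠ nA → G.edgeGp (Sum.inl n) =
      ((Subgroup.closure (bB '' {Sum.inr ⟨s₁ - 1, hslot⟩})).map ι).topologicalClosure := fun n hn => by
    rw [hEn n, hxB n hn, Set.image_singleton, hkB, Subgroup.zpowers_eq_closure]
  have hEnA : ∀ n, n = nA → G.edgeGp (Sum.inl n) = ((Subgroup.zpowers (θ (c 0))).map ι).topologicalClosure :=
    fun n hn => by rw [hEn n, hxA n hn, hεη, Subgroup.zpowers_inv, hθc]
  have hιn : ∀ n, ι (xs n) ∈ G.edgeGp (Sum.inl n) := fun n => by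
    rw [hEn]
    exact Subgroup.le_topologicalClosure _ (Subgroup.mem_map_of_mem ι (Subgroup.mem_zpowers _))
  have hιc : ∀ c', ι (c (e c')) ∈ G.edgeGp (Sum.inr c') := fun c' => by
    rw [hEc]
    exact Subgroup.le_topologicalClosure _ (Subgroup.mem_map_of_mem ι (Subgroup.mem_zpowers _))
  -- two marked points at least: `c_0` on `C₁`, `c_{s₁}` on `C_mid`
  have hother : ∀ k : Fin (r' + 1), ∃ j : Fin (r' + 1), j ≠ k := fun k => by
    by_cases hk : (k : ℕ) = 0
    · exact ⟨⟨s₁, by omega⟩, fun h => by rw [← h] at hk; simp only at hk; omega⟩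
    · exact ⟨⟨0, by omega⟩, fun h => by rw [← h] at hk; exact hk rfl⟩
  have hK₁ : ∀ k : Fin (r' + 1), (∃ j : Fin (r' + 1), (j : ℕ) < s₁ ∧ j ≠ k) ∨ ((k : ℕ) < s₁ ∧ 0 + g' < 0 + g') := by
    intro k
    by_cases hk : k = ⟨0, by omega⟩
    · rcases hst₁ with h | h
      · exact Or.inr ⟨by rw [hk]; simp only; omega, by omega⟩
      · exact Or.inl ⟨⟨1, by omega⟩, by simp only; omega, fun h' => by
          rw [hk] at h'; exact absurd (congrArg Fin.val h') (by simp)⟩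
    · exact Or.inl ⟨⟨0, by omega⟩, by simp only; omega, fun h' => hk h'.symm⟩
  intro V hVn hVo
  haveI := hVn
  refine ⟨V, hVn, hVo, le_rfl, ?_⟩
  -- the finite `Σ`-targets mod `ℓ^m`, `m = [Π : V]`
  have hVi : IsSigmaInteger Sigma V.index := hι.index_open V hVn hVo
  obtain ⟨m, hm⟩ : ∃ m : ℕ, m = V.index := ⟨_, rfl⟩
  have hmpos : 0 < m := by rw [hm]; exact hVi.1
  have hfin : ∀ {M : Type} [Group M] (u : M), u ^ m ≠ 1 → u ^ V.index ≠ 1 := fun u h => by rwa [← hm]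
  have hmlt : m < ℓ ^ m := Nat.lt_pow_self hℓ.one_lt
  haveI : NeZero (ℓ ^ m) := ⟨pow_ne_zero _ hℓ.ne_zero⟩
  have hZM : IsSigmaInteger Sigma (Nat.card (Multiplicative (ZMod (ℓ ^ m)))) := by
    rw [show Nat.card (Multiplicative (ZMod (ℓ ^ m))) = ℓ ^ m from Nat.card_zmod (ℓ ^ m)]
    exact Literature.AnabelianGeometry.SemiGraphs.isSigmaInteger_prime_pow hℓ hℓS _
  have hpow1 : (ofAdd (1 : ZMod (ℓ ^ m))) ^ m ≠ 1 := by
    rw [← ofAdd_nsmul, nsmul_eq_mul, mul_one, Ne, ofAdd_eq_one, ZMod.natCast_eq_zero_iff]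
    exact fun h => absurd (Nat.le_of_dvd hmpos h) (not_le.mpr hmlt)
  obtain ⟨φH, X, Y, Z, hXYZ, -, hZpow, hcard⟩ := Heisenberg.exists_heisenbergTriple_central (ℓ ^ m)
  haveI : Finite (Multiplicative (ZMod (ℓ ^ m) × ZMod (ℓ ^ m)) ⋊[φH] Multiplicative (ZMod (ℓ ^ m))) :=
    Nat.finite_of_card_ne_zero (by rw [hcard]; exact pow_ne_zero _ (pow_ne_zero _ hℓ.ne_zero))
  have hHM : IsSigmaInteger Sigma
      (Nat.card (Multiplicative (ZMod (ℓ ^ m) × ZMod (ℓ ^ m)) ⋊[φH] Multiplicative (ZMod (ℓ ^ m)))) := by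
    rw [hcard, ← pow_mul]
    exact Literature.AnabelianGeometry.SemiGraphs.isSigmaInteger_prime_pow hℓ hℓS _
  have hZm : Z ^ m ≠ 1 := fun h => absurd (Nat.le_of_dvd hmpos ((hZpow m).mp h)) (not_le.mpr hmlt)
  have hZm' : Z⁻¹ ^ m ≠ 1 := by rw [inv_pow]; exact inv_ne_one.mpr hZm
  have hW : X * Y * X⁻¹ * Y⁻¹ * Z⁻¹ = 1 := by rw [hXYZ, mul_inv_cancel]
  -- abelian certificates `δ_k − δ_m` mod `ℓ^m`: they kill `ε_A`; value on `η` is `[s₁ ≤ k] − [s₁ ≤ m]`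
  have habel : ∀ k m' : Fin (r' + 1), k ≠ m' →
      ∃ χ : PuncturedSurfaceGroup (0 + g') (r' + 1) →* Multiplicative (ZMod (ℓ ^ m)),
        χ (c k) = ofAdd 1 ∧ (∀ j, j ≠ k → j ≠ m' → χ (c j) = 1) ∧ χ εA = 1 ∧
          χ η = ofAdd ((if s₁ ≤ (k : ℕ) then (1 : ZMod (ℓ ^ m)) else 0) +
            (if s₁ ≤ (m' : ℕ) then (-1 : ZMod (ℓ ^ m)) else 0)) := by
    intro k m' hkm
    obtain ⟨χ, -, -, hχc⟩ := exists_handleCuspCharacter (g := 0 + g') (r := r' + 1) (n := ℓ ^ m)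
      (fun _ => 0) (fun _ => 0)
      (fun j => (if j = k then (1 : ZMod (ℓ ^ m)) else 0) + (if j = m' then (-1 : ZMod (ℓ ^ m)) else 0))
      (sum_twoDelta k m')
    refine ⟨χ, ?_, fun j hjk hjm => ?_, ?_, ?_⟩
    · rw [hχc, if_pos rfl, if_neg hkm, add_zero]
    · rw [hχc, if_neg hjk, if_neg hjm, add_zero, ofAdd_zero]
    · rw [hεA, character_nodeLoop χ hχc (0 + g') (r' + 1), sum_ite_twoDelta, if_neg (by omega), if_neg (by omega),
        add_zero, ofAdd_zero]
    · rw [hη, character_nodeLoop χ hχc (0 + g') s₁, sum_ite_twoDelta]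
  -- Heisenberg certificates: handle `i₀`, cusp `j₀ ↦ Z⁻¹`
  have hheis : ∀ (i₀ : Fin (0 + g')) (j₀ : Fin (r' + 1)),
      ∃ ψ : PuncturedSurfaceGroup (0 + g') (r' + 1) →*
        Multiplicative (ZMod (ℓ ^ m) × ZMod (ℓ ^ m)) ⋊[φH] Multiplicative (ZMod (ℓ ^ m)),
        ψ (c j₀) = Z⁻¹ ∧ (∀ j, j ≠ j₀ → ψ (c j) = 1) ∧
          ψ εA = (if (i₀ : ℕ) < 0 + g' then Z else 1) ∧
          ψ η = (if s₁ ≤ (j₀ : ℕ) then Z⁻¹ else 1) * (if (i₀ : ℕ) < 0 + g' then Z else 1) := by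
    intro i₀ j₀
    obtain ⟨ψ, ha', hb', hc', hab, hcj⟩ := exists_hom_handle_cusp (g := 0 + g') (r := r' + 1) i₀ j₀ X Y Z⁻¹ hW
    refine ⟨ψ, hc', hcj, ?_, ?_⟩
    · rw [hεA, hom_handle_cusp_nodeLoop ψ ha' hb' hc' hab hcj (0 + g') (r' + 1), if_neg (by omega), one_mul, hXYZ]
    · rw [hη, hom_handle_cusp_nodeLoop ψ ha' hb' hc' hab hcj (0 + g') s₁, hXYZ]
  have hkill : ∀ {M : Type} [Group M] (φ : PuncturedSurfaceGroup (0 + g') (r' + 1) →* M)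
      (z : PuncturedSurfaceGroup (0 + g') (r' + 1)), φ z = 1 → ∀ x ∈ Subgroup.zpowers z, φ x = 1 := by
    intro M _ φ z hz x hx
    obtain ⟨t, rfl⟩ := Subgroup.mem_zpowers_iff.mp hx
    rw [map_zpow, hz, one_zpow]
  have h0g₀ : ((⟨0, by omega⟩ : Fin (0 + g')) : ℕ) < 0 + g' := by simp only; omega
  have h0g₁ : ((⟨0, by omega⟩ : Fin (0 + g')) : ℕ) < 0 + g' := by simp only; omega
  rintro (n₁ | c₁) (n₂ | c₂) γ₁ γ₂ hne12
  · -- node / node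
    by_cases h12 : n₁ = n₂
    · subst h12
      have hne' := hne12.resolve_left fun h => h rfl
      by_cases h1 : n₁ = nA
      · -- `ν_A / ν_A`: abc-iut-f-164's boundary-node theorem for `B = ⟨a_i, b_i⟩ = θ(Γ_{g,1})`, `θ(c_0) = ε_A⁻¹`
        exact boundaryNode_exists_open_separating_sameEdge hι bB S_H _ rfl (by omega : 1 ≤ g') θ hθinj hθB hℓ hℓS
          (G.edgeGp (Sum.inl n₁)) (hEnA n₁ h1) V hVo γ₁ γ₂ hne'
      · -- `ν_B / ν_B`: fibred twist along the basis member `η`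
        have hA := hEnB n₁ h1
        exact freeFactor_exists_open_separating_sameVertex hι bB _ (Set.singleton_nonempty _) hℓ hℓS _ hA V
          hVo γ₁ γ₂ hne'
    · by_cases h1 : n₁ = nA
      · -- alive `ε_A`, killed `η`: Heisenberg at the handle `0` of `C₀` with the cusp `c_{s₁}`
        have h2 : n₂ ≠ nA := fun h => h12 (h1.trans h.symm)
        obtain ⟨ψ, -, -, hψA, hψB⟩ := hheis ⟨0, by omega⟩ ⟨s₁, by omega⟩
        refine exists_open_separating_of_hom hι hHM ψ (G.edgeGp (Sum.inl n₂)) (Subgroup.zpowers (xs n₂))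
          (hEn n₂) (hkill ψ _ ?_) (G.edgeGp (Sum.inl n₁)) (xs n₁) (hιn n₁) V hVo ?_ γ₁ γ₂
        · rw [hxB n₂ h2, hψB, if_pos (show s₁ ≤ ((⟨s₁, _⟩ : Fin (r' + 1)) : ℕ) from le_rfl), if_pos h0g₁,
            inv_mul_cancel]
        · rw [hxA n₁ h1, hψA, if_pos h0g₀]
          exact hfin _ hZm
      · -- alive `η`, killed `ε_A`: the character `δ_{s₁} − δ_0`
        have h2 : n₂ = nA := by
          rcases hN n₂ with h | h
          · exact h
          · rcases hN n₁ with h' | h'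
            · exact absurd h' h1
            · exact absurd (h'.trans h.symm) h12
        obtain ⟨χ, -, -, hχA, hχB⟩ := habel ⟨s₁, by omega⟩ ⟨0, by omega⟩
          (fun h => by have := congrArg Fin.val h; simp only at this; omega)
        refine exists_open_separating_of_hom hι hZM χ (G.edgeGp (Sum.inl n₂)) (Subgroup.zpowers (xs n₂))
          (hEn n₂) (hkill χ _ (by rw [hxA n₂ h2, hχA])) (G.edgeGp (Sum.inl n₁)) (xs n₁) (hιn n₁) V hVo ?_ γ₁ γ₂
        rw [hxB n₁ h1, hχB, if_pos (show s₁ ≤ ((⟨s₁, _⟩ : Fin (r' + 1)) : ℕ) from le_rfl),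
          if_neg (show ¬ s₁ ≤ ((⟨0, _⟩ : Fin (r' + 1)) : ℕ) by simp only; omega), add_zero]
        exact hfin _ hpow1
  · -- alive: a node; killed: the cusp `k = e c₂`
    by_cases h1 : n₁ = nA
    · -- `ε_A` alive: Heisenberg at the handle `0` of `C₀` with another cusp
      obtain ⟨j₀, hj₀⟩ := hother (e c₂)
      obtain ⟨ψ, -, hψj, hψA, -⟩ := hheis ⟨0, by omega⟩ j₀
      refine exists_open_separating_of_hom hι hHM ψ (G.edgeGp (Sum.inr c₂)) (Subgroup.zpowers (c (e c₂)))
        (hEc c₂) (hkill ψ _ (hψj _ hj₀.symm)) (G.edgeGp (Sum.inl n₁)) (xs n₁) (hιn n₁) V hVo ?_ γ₁ γ₂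
      rw [hxA n₁ h1, hψA, if_pos h0g₀]
      exact hfin _ hZm
    · by_cases hk : (e c₂ : ℕ) < s₁
      · rcases hK₁ (e c₂) with ⟨j₂, hj₂, hj₂k⟩ | ⟨-, hg₁g⟩
        · -- a spare `C₁` cusp `j₂`: the character `δ_{s₁} − δ_{j₂}`
          have hjs : (⟨s₁, by omega⟩ : Fin (r' + 1)) ≠ e c₂ := fun h => by rw [← h] at hk; simp only at hk; omega
          have hj2s : (⟨s₁, by omega⟩ : Fin (r' + 1)) ≠ j₂ := fun h => by rw [← h] at hj₂; simp only at hj₂; omega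
          obtain ⟨χ, -, hχ0, -, hχB⟩ := habel ⟨s₁, by omega⟩ j₂ hj2s
          refine exists_open_separating_of_hom hι hZM χ (G.edgeGp (Sum.inr c₂)) (Subgroup.zpowers (c (e c₂)))
            (hEc c₂) (hkill χ _ (hχ0 _ hjs.symm hj₂k.symm)) (G.edgeGp (Sum.inl n₁)) (xs n₁) (hιn n₁) V hVo ?_
            γ₁ γ₂
          rw [hxB n₁ h1, hχB, if_pos (show s₁ ≤ ((⟨s₁, _⟩ : Fin (r' + 1)) : ℕ) from le_rfl), if_neg (by omega),
            add_zero]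
          exact hfin _ hpow1
        · -- `C₁` has a single marked point: Heisenberg at a `C₁` handle with the cusp `c_{s₁}`
          obtain ⟨ψ, -, hψj, -, hψB⟩ := hheis ⟨0 + g', hg₁g⟩ ⟨s₁, by omega⟩
          refine exists_open_separating_of_hom hι hHM ψ (G.edgeGp (Sum.inr c₂)) (Subgroup.zpowers (c (e c₂)))
            (hEc c₂) (hkill ψ _ (hψj _ fun h => by rw [h] at hk; simp only at hk; omega))
            (G.edgeGp (Sum.inl n₁)) (xs n₁) (hιn n₁) V hVo ?_ γ₁ γ₂
          rw [hxB n₁ h1, hψB, if_pos (show s₁ ≤ ((⟨s₁, _⟩ : Fin (r' + 1)) : ℕ) from le_rfl),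
            if_neg (show ¬ ((⟨0 + g', hg₁g⟩ : Fin (0 + g')) : ℕ) < 0 + g' from lt_irrefl _), mul_one]
          exact hfin _ hZm'
      · -- killed a `C_mid` cusp: Heisenberg at the handle `0` with the cusp `c_0` of `C₁`
        obtain ⟨ψ, -, hψj, -, hψB⟩ := hheis ⟨0, by omega⟩ ⟨0, by omega⟩
        refine exists_open_separating_of_hom hι hHM ψ (G.edgeGp (Sum.inr c₂)) (Subgroup.zpowers (c (e c₂)))
          (hEc c₂) (hkill ψ _ (hψj _ fun h => by rw [h] at hk; simp only at hk; omega))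
          (G.edgeGp (Sum.inl n₁)) (xs n₁) (hιn n₁) V hVo ?_ γ₁ γ₂
        rw [hxB n₁ h1, hψB, if_neg (show ¬ s₁ ≤ ((⟨0, _⟩ : Fin (r' + 1)) : ℕ) by simp only; omega), if_pos h0g₁,
          one_mul]
        exact hfin _ hZm
  · -- alive: the cusp `k = e c₁`; killed: a node
    by_cases h2 : n₂ = nA
    · -- killed `ε_A`: any cusp character kills it
      obtain ⟨m', hmk⟩ := hother (e c₁)
      obtain ⟨χ, hχk, -, hχA, -⟩ := habel (e c₁) m' hmk.symm
      exact exists_open_separating_of_hom hι hZM χ (G.edgeGp (Sum.inl n₂)) (Subgroup.zpowers (xs n₂))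
        (hEn n₂) (hkill χ _ (by rw [hxA n₂ h2, hχA])) (G.edgeGp (Sum.inr c₁)) (c (e c₁)) (hιc c₁) V hVo
        (by rw [hχk]; exact hfin _ hpow1) γ₁ γ₂
    · by_cases hk : s₁ ≤ (e c₁ : ℕ)
      · -- alive `C_mid` cusp, killed `η`: Heisenberg at the handle `0` with the cusp `k` itself
        obtain ⟨ψ, hψk, -, -, hψB⟩ := hheis ⟨0, by omega⟩ (e c₁)
        refine exists_open_separating_of_hom hι hHM ψ (G.edgeGp (Sum.inl n₂)) (Subgroup.zpowers (xs n₂))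
          (hEn n₂) (hkill ψ _ ?_) (G.edgeGp (Sum.inr c₁)) (c (e c₁)) (hιc c₁) V hVo (by rw [hψk]; exact hfin _ hZm')
          γ₁ γ₂
        rw [hxB n₂ h2, hψB, if_pos hk, if_pos h0g₁, inv_mul_cancel]
      · rcases hK₁ (e c₁) with ⟨m', hm', hmk⟩ | ⟨-, hg₁g⟩
        · -- a spare `C₁` cusp `m'`: `δ_k − δ_{m'}` kills `η`
          obtain ⟨χ, hχk, -, -, hχB⟩ := habel (e c₁) m' hmk.symm
          refine exists_open_separating_of_hom hι hZM χ (G.edgeGp (Sum.inl n₂)) (Subgroup.zpowers (xs n₂))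
            (hEn n₂) (hkill χ _ ?_) (G.edgeGp (Sum.inr c₁)) (c (e c₁)) (hιc c₁) V hVo (by rw [hχk]; exact hfin _ hpow1)
            γ₁ γ₂
          rw [hxB n₂ h2, hχB, if_neg hk, if_neg (by omega), add_zero, ofAdd_zero]
        · -- `C₁` has a single marked point: Heisenberg at a `C₁` handle with the cusp `k`
          obtain ⟨ψ, hψk, -, -, hψB⟩ := hheis ⟨0 + g', hg₁g⟩ (e c₁)
          refine exists_open_separating_of_hom hι hHM ψ (G.edgeGp (Sum.inl n₂)) (Subgroup.zpowers (xs n₂))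
            (hEn n₂) (hkill ψ _ ?_) (G.edgeGp (Sum.inr c₁)) (c (e c₁)) (hιc c₁) V hVo (by rw [hψk]; exact hfin _ hZm')
            γ₁ γ₂
          rw [hxB n₂ h2, hψB, if_neg hk, if_neg (show ¬ ((⟨0 + g', hg₁g⟩ : Fin (0 + g')) : ℕ) < 0 + g' from lt_irrefl _), mul_one]
  · -- cusp / cusp
    by_cases h12 : c₁ = c₂
    · subst h12
      have hne' := hne12.resolve_left fun h => h rfl
      obtain ⟨β, bs, k, hk⟩ := exists_freeGroupBasis_eq_c (g := 0 + g') (by omega : 2 ≤ r' + 1) (e c₁)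
      have hform : G.edgeGp (Sum.inr c₁) = ((Subgroup.closure (bs '' {k})).map ι).topologicalClosure := by
        rw [hEc, Set.image_singleton, hk, Subgroup.zpowers_eq_closure]
      exact freeFactor_exists_open_separating_sameVertex hι bs _ (Set.singleton_nonempty _) hℓ hℓS _ hform V hVo
        γ₁ γ₂ hne'
    · have hkm : e c₁ ≠ e c₂ := fun h => h12 (e.injective h)
      obtain ⟨ψ, hψk, hψj, -, -⟩ := hheis ⟨0, by omega⟩ (e c₁)
      exact exists_open_separating_of_hom hι hHM ψ (G.edgeGp (Sum.inr c₂)) (Subgroup.zpowers (c (e c₂)))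
        (hEc c₂) (hkill ψ _ (hψj _ hkm.symm)) (G.edgeGp (Sum.inr c₁)) (c (e c₁)) (hιc c₁) V hVo
        (by rw [hψk]; exact hfin _ hZm') γ₁ γ₂

end ThreeChain

end PSCDatum

end Literature.AnabelianGeometry.SemiGraphs

end
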